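import Literature.NumberTheory.IwasawaTheory.ClassGroupPRankLeOfRelationTwo
import Literature.NumberTheory.IwasawaTheory.ClassGroupPRankLeOfNotElementaryLayerSubOneTwo
import HarnessLib

/-!
# THE RELATION DOOR at `p = 2`, ANY LAYER `K_n` (`n = j + 2 ≥ 2`), in base-field currency: `2 ∤ h_K`, two dyadic primes, a unit `u` of `K` with
# `u^{2^j} ∉ N_{K_n/K} K_nˣ` (so `4 ∤ #Cl(K_n)^G`), the genus certificate for `N_{K_n/K_1}(c)`, and ONE relation of order `d ≤ 2^n − 2` ⟹ `μ₂ = 0`, `λ₂ ≤ d`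

Topic `NumberTheory/IwasawaTheory` (namespace = path).  THEOREMS ONLY (no definition, no named fact, no instance, no `sorry`); unconditional.
Written by the prover seat `bsd-line-att-p3` g48 (cell `bsd-f1-sign2`, WIDTH-5 attach on route `AlignedTransportAtTwo`, crux C2 stmt-BirchSwinnertonDyer-22298;
`--supports`, closes nothing).  Sequel of this seat's `ClassGroupPRankLeOfRelationTwo` (layer `2`): the same door at the layer `K_{j+2}` — the habitat of the hard-core
seeds that are silent at layer `2` (relation of order `3 ≤ d ≤ 6` at layer `3`, degree `24`, where a class NUMBER is not kernel-certifiable but ONE principal generator is).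

* `pow_dvd_relIndex_unitsNorm_of_pow_not_mem` — `L/K` Galois of degree `p^k`, a unit `u` of `K` with **`u^{p^j} ∉ N_{L/K} Lˣ`** ⟹ **`p^{j+1} ∣ [E_K : E_K ∩ N Lˣ]`**
  (the coset of `u` has order `> p^j` and divides `p^k`; `j = 0`: att-p3 g46, `j = 1`: att-p3 g47).
* ★ `not_four_dvd_card_fixed_layer_of_pow_not_mem` — `κ` with Fukuda index `0`, `2 ∤ h_K`, exactly two primes ramified in `K_{j+2}`, `u^{2^j} ∉ N_{K_{j+2}/K}` ⟹
  **`4 ∤ #Cl(K_{j+2})^{Gal}`** (Chevalley: `#fix · 2^{j+2} · idx = h_K · (2^{j+2})²` with `2^{j+1} ∣ idx`).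
* ★ `exists_sq_eq_classGroupNorm_layer_one_of_layer` / ★★ `not_exists_eq_conj_div_mul_sq_of_genusCert_layer` — the generator certificate at layer `n`:
  `N_{K_n/K_1}(σb·b⁻¹·e²)` is a square in `Cl(K_1)` (any `σ ∈ Gal(K_n/K)`), so the non-square genus certificate for `N_{K_n/K_1}(c)` puts `c` outside `Cl(K_n)^{σ−1}·Cl(K_n)²`.
* ★★★ `classicalMuVanishes_two_of_relation_of_genusCert_layer` — THE DOOR at layer `j + 2`: odd degree, `2 ∤ d_K`, `κ` cyclotomic, two dyadic primes, `2 ∤ h_K`,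
  `𝓞_K/𝔭₁ = 𝔽₂`, units `≡ ±1 (mod 𝔭₁³)`, a unit `ε` with **`ε^{2^j} ∉ N_{K_{j+2}/K} K_{j+2}ˣ` DISPLAYED** (`j = 0`: `ε ∓ 1 ∉ 𝔭₁⁴`, tree; `j = 1`: `ε² ≢ ±1 (mod 𝔭₁⁵)` — the
  level-`32` dyadic lemma is NOT in the tree yet), the genus certificate `(𝔄, k, π)` for `N_{K_{j+2}/K_1}(c)`, `σ` generating, ONE relation of order `d` with `d + 2 ≤ 2^{j+2}`
  ⟹ `rank₂ Cl(K_m) ≤ d ∀ m`, `μ₂(κ) = 0`, `λ₂(κ) ≤ d`.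

HONEST SCOPE: classical (Chevalley–Lang, Washington §13.3 at finite level, genus theory's elementary half); nothing specific to any summit; no certificate for any field is
asserted; BSD is not advanced by this file.

## References

* S. Lang, *Cyclotomic Fields I and II*, GTM 121 (1990), Ch. 13 §4 Lemma 4.1–4.2 (PDF pp. 203–204). [Lang1990]
* L. C. Washington, *Introduction to Cyclotomic Fields*, 2nd ed. (1997), §13.3 Prop. 13.22–13.23. [Washington1997]
* G. Gras, *Class Field Theory* (2003), II.6.2.3, IV.4. [Gras2003]
* J. Neukirch, *Algebraic Number Theory* (1999), Ch. III §1 (1.6). [NeukirchANT1999]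
* T. Fukuda, *Remarks on `ℤ_p`-extensions of number fields*, Proc. Japan Acad. 70 A (1994), Thm. 1. [Fukuda1994]
-/

set_option autoImplicit false

noncomputable section

open scoped NumberField nonZeroDivisors
open NumberField IsDedekindDomain Field Polynomial Finset

namespace Literature.NumberTheory.IwasawaTheory

open Literature.NumberTheory.EllipticCurves Literature.NumberTheory.NumberFields Literature.NumberTheory.NumberFields.AmbiguousClass
  Literature.NumberTheory.GaloisRepresentations Literature.NumberTheory.GaloisRepresentations.Herbrand
  Literature.NumberTheory.GaloisRepresentations.MinkowskiUnit Literature.NumberTheory.GaloisRepresentations.CyclicNormIndex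

/-! ## §1 `p^{j+1} ∣ [E_K : E_K ∩ N Lˣ]` from `u^{p^j} ∉ N Lˣ` -/

section Index

variable {K L : Type} [Field K] [NumberField K] [Field L] [NumberField L] [Algebra K L]

/-- **`p^{j+1} ∣ [E_K : E_K ∩ N_{L/K} Lˣ]` as soon as `u^{p^j}` is not a norm from `L` for ONE unit `u` of `K`** (`L/K` Galois of degree `p^k`): the coset of `u` in
`E_K/(E_K ∩ N Lˣ)` has order dividing `p^k` (`u^{[L:K]} = N(u)`) and not dividing `p^j`. [cite: Lang1990, Ch. 13 §4, Lemma 4.1 and proof of Lemma 4.2 (PDF pp. 203–204)] -/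
theorem pow_dvd_relIndex_unitsNorm_of_pow_not_mem [IsGalois K L] {p k : ℕ} (hp : p.Prime) (hdeg : Module.finrank K L = p ^ k) {u : Lˣ}
    (hu : u ∈ unitsE L ⊓ (unitsIncl K L).range) {j : ℕ} (hnot : u ^ p ^ j ∉ (⊤ : Subgroup Lˣ).map (Herbrand.norm (L ≃ₐ[K] L))) :
    p ^ (j + 1) ∣ (unitsE L ⊓ (⊤ : Subgroup Lˣ).map (Herbrand.norm (L ≃ₐ[K] L))).relIndex (unitsE L ⊓ (unitsIncl K L).range) := by
  classical
  haveI : Fact p.Prime := ⟨hp⟩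
  set H := unitsE L ⊓ (⊤ : Subgroup Lˣ).map (Herbrand.norm (L ≃ₐ[K] L)) with hH
  set E := unitsE L ⊓ (unitsIncl K L).range with hE
  have hpowH : u ^ p ^ k ∈ H := by
    rw [← hdeg]; exact ⟨(unitsE L).pow_mem hu.1 _, pow_finrank_mem_map_norm hu.2⟩
  set q : E ⧸ H.subgroupOf E := QuotientGroup.mk ⟨u, hu⟩ with hq
  have hqpj : q ^ p ^ j ≠ 1 := by
    intro h1
    rw [hq, ← QuotientGroup.mk_pow, QuotientGroup.eq_one_iff, Subgroup.mem_subgroupOf] at h1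
    exact hnot h1.2
  have hqpk : q ^ p ^ k = 1 := by
    rw [hq, ← QuotientGroup.mk_pow, QuotientGroup.eq_one_iff, Subgroup.mem_subgroupOf]
    exact hpowH
  obtain ⟨i, -, hi⟩ := (Nat.dvd_prime_pow hp).mp (orderOf_dvd_of_pow_eq_one hqpk)
  have hij : j + 1 ≤ i := by
    by_contra hlt
    push Not at hlt
    apply hqpj
    have hdvd : orderOf q ∣ p ^ j := by rw [hi]; exact Nat.pow_dvd_pow p (by omega)
    exact orderOf_dvd_iff_pow_eq_one.mp hdvd
  have hpq : p ^ (j + 1) ∣ orderOf q := by rw [hi]; exact Nat.pow_dvd_pow p hij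
  rw [Subgroup.relIndex, Subgroup.index]
  exact hpq.trans (orderOf_dvd_natCard q)

end Index

/-! ## §2 Chevalley's count at the layer `K_{j+2}`: `4 ∤ #Cl(K_{j+2})^G` -/

section Chevalley

variable {K : Type} [Field K] [NumberField K]

/-- ★ **`4 ∤ #Cl(K_{j+2})^{Gal(K_{j+2}/K)}`** for a `ℤ₂`-extension with Fukuda index `0`, `2 ∤ h_K`, EXACTLY two primes of `K` ramified in `K_{j+2}`, and a unit `u` of `K` with
`u^{2^j} ∉ N_{K_{j+2}/K} K_{j+2}ˣ`: Chevalley's formula `#fix · 2^{j+2} · [E_K : E_K ∩ N] = h_K · (2^{j+2})²` (tree `ambiguousClassNumberFormula`, `∏ e_𝔭 = (2^{j+2})²`, `e_∞ = 1`) with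
`2^{j+1} ∣ [E_K : E_K ∩ N]` (§1) gives `#fix ∣ 2 h_K`. [cite: Lang1990, Ch. 13 §4, Lemma 4.1 (PDF pp. 203–204)] [cite: Gras2003, II.6.2.3] [cite: Washington1997, §13.1 Prop. 13.2] -/
theorem not_four_dvd_card_fixed_layer_of_pow_not_mem (κ : ZpExtension K 2) (hκ : TotallyRamifiedFrom κ 0) (hK : ¬ 2 ∣ classNumber K) (j : ℕ)
    [NumberField (κ.layer (j + 2))]
    (hs : {v : HeightOneSpectrum (𝓞 K) | v.asIdeal.ramificationIdxIn (𝓞 (κ.layer (j + 2))) ≠ 1}.ncard = 2)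
    {u : (κ.layer (j + 2))ˣ} (hu : u ∈ unitsE (κ.layer (j + 2)) ⊓ (unitsIncl K (κ.layer (j + 2))).range)
    (hnot : u ^ 2 ^ j ∉ (⊤ : Subgroup (κ.layer (j + 2))ˣ).map (Herbrand.norm ((κ.layer (j + 2)) ≃ₐ[K] (κ.layer (j + 2))))) :
    ¬ 4 ∣ Nat.card {c : ClassGroup (𝓞 (κ.layer (j + 2))) //
      ∀ τ : (κ.layer (j + 2)) ≃ₐ[K] (κ.layer (j + 2)), ClassGroup.mulEquiv (intAut τ) c = c} := by
  classical
  haveI : Fact (Nat.Prime 2) := ⟨Nat.prime_two⟩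
  haveI : FiniteDimensional K (κ.layer (j + 2)) := κ.finiteDimensional_layer_holds (j + 2)
  haveI : IsGalois K (κ.layer (j + 2)) := κ.isGalois_layer_holds (j + 2)
  haveI : IsUnramifiedAtInfinitePlaces K (κ.layer (j + 2)) := κ.isUnramifiedAtInfinitePlaces_layer (j + 2)
  obtain ⟨ψ, -, hker, -⟩ := κ.exists_cyclicCharacter_layer (j + 2)
  haveI : IsCyclic ((κ.layer (j + 2)) ≃ₐ[K] (κ.layer (j + 2))) := isCyclic_of_cyclicLayer ψ (κ.layer (j + 2)) hker
  obtain ⟨σ, hσ⟩ := IsCyclic.exists_generator (α := (κ.layer (j + 2)) ≃ₐ[K] (κ.layer (j + 2)))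
  have h := ambiguousClassNumberFormula hσ
  rw [κ.finrank_layer_holds (j + 2), archFactor_eq_one, mul_one, finprod_ramificationIdxIn_layer_eq_pow κ hκ (j + 2), hs] at h
  -- h : #fix * 2^(j+2) * idx = h_K * (2^(j+2))^2
  have hdeg : Module.finrank K (κ.layer (j + 2)) = 2 ^ (j + 2) := κ.finrank_layer_holds (j + 2)
  obtain ⟨b, hb⟩ := pow_dvd_relIndex_unitsNorm_of_pow_not_mem Nat.prime_two hdeg hu hnot
  rintro ⟨a, ha⟩
  rw [ha, hb] at h
  apply hK
  -- `4a · 2^(j+2) · 2^(j+1) b = h_K · 2^(j+2) · 2^(j+2)` ⟹ `h_K = 2ab`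
  refine ⟨a * b, Nat.eq_of_mul_eq_mul_right (by positivity : 0 < 2 ^ (j + 2) * 2 ^ (j + 2)) ?_⟩
  have h' : classNumber K * (2 ^ (j + 2) * 2 ^ (j + 2)) = 4 * a * 2 ^ (j + 2) * (2 ^ (j + 1) * b) := by rw [h]; ring
  rw [h']
  ring

end Chevalley

/-! ## §3 The generator certificate at layer `n` -/

section Layer

variable {K : Type} [Field K] [NumberField K]

/-- ★ **`N_{K_n/K_1}(σ(b)·b⁻¹·e²)` is a square in `Cl(K_1)`** (`2 ∤ h_K`, ANY `σ ∈ Gal(K_n/K)`, any compatible algebra structure `K_1 → K_n`): `N(σb) = σ₁ N b` by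
`Γ`-equivariance; if `σ₁ = 1` nothing is left, else `Gal(K_1/K) = {1, σ₁}` and `y·σ₁y = i(N_{K_1/K} y)` is a class of ODD order — a square.
[cite: NeukirchANT1999, Ch. III §1 Prop. (1.6) (iv)] [cite: Washington1997, §13.3 (norm maps are `Γ`-maps)] -/
theorem exists_sq_eq_classGroupNorm_layer_one_of_layer (κ : ZpExtension K 2) (hK : ¬ 2 ∣ classNumber K) (n : ℕ)
    [NumberField (κ.layer 1)] [NumberField (κ.layer n)] [Algebra (κ.layer 1) (κ.layer n)] [IsScalarTower K (κ.layer 1) (κ.layer n)]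
    (σ : (κ.layer n) ≃ₐ[K] (κ.layer n)) {c b e : ClassGroup (𝓞 (κ.layer n))}
    (h : c = ClassGroup.mulEquiv (intAut σ) b / b * e ^ 2) :
    ∃ y : ClassGroup (𝓞 (κ.layer 1)), y ^ 2 = classGroupNorm (κ.layer 1) (κ.layer n) c := by
  classical
  haveI : Fact (Nat.Prime 2) := ⟨Nat.prime_two⟩
  haveI : FiniteDimensional K (κ.layer 1) := κ.finiteDimensional_layer_holds 1
  haveI : FiniteDimensional K (κ.layer n) := κ.finiteDimensional_layer_holds n
  haveI : IsGalois K (κ.layer 1) := κ.isGalois_layer_holds 1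
  haveI : IsGalois K (κ.layer n) := κ.isGalois_layer_holds n
  haveI : Normal K (κ.layer 1) := IsGalois.to_normal
  haveI : Normal K (κ.layer n) := IsGalois.to_normal
  obtain ⟨γ, hγ⟩ := absRestrictNormalHom_surjective (κ.layer n) σ
  set N := classGroupNorm (κ.layer 1) (κ.layer n) with hN
  set σ₁ : (κ.layer 1) ≃ₐ[K] (κ.layer 1) := absRestrictNormalHom (κ.layer 1) γ with hσ₁
  set y₀ := N b with hy₀
  have hNσ : N (ClassGroup.mulEquiv (intAut σ) b) = ClassGroup.mulEquiv (intAut σ₁) y₀ := by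
    rw [← hγ, hN, classGroupNorm_layer_layer_mulEquiv_intAut_absRestrictNormalHom κ γ b]
  have hsq : ∃ w : ClassGroup (𝓞 (κ.layer 1)), w ^ 2 = ClassGroup.mulEquiv (intAut σ₁) y₀ / y₀ := by
    by_cases h1 : σ₁ = 1
    · refine ⟨1, ?_⟩
      rw [h1, mulEquiv_intAut_one, MulEquiv.refl_apply, div_self', one_pow]
    · have hne1 : (1 : (κ.layer 1) ≃ₐ[K] (κ.layer 1)) ≠ σ₁ := fun h' => h1 h'.symm
      have huniv : ({1, σ₁} : Finset ((κ.layer 1) ≃ₐ[K] (κ.layer 1))) = Finset.univ := by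
        refine Finset.eq_univ_of_card _ ?_
        rw [Finset.card_pair hne1, ← Nat.card_eq_fintype_card, IsGalois.card_aut_eq_finrank, κ.finrank_layer_holds 1, pow_one]
      have hprod : y₀ * ClassGroup.mulEquiv (intAut σ₁) y₀ =
          classGroupExtend K (κ.layer 1) (classGroupNorm K (κ.layer 1) y₀) := by
        rw [classGroupExtend_classGroupNorm_eq_prod K (κ.layer 1) y₀, ← huniv, Finset.prod_pair hne1, mulEquiv_intAut_one,
          MulEquiv.refl_apply]
      set z := classGroupNorm K (κ.layer 1) y₀ with hz
      obtain ⟨m, hm⟩ : Odd (classNumber K) := Nat.odd_iff.mpr (Nat.two_dvd_ne_zero.mp hK)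
      have hzsq : z = (z ^ (m + 1)) ^ 2 := by
        rw [← pow_mul, show (m + 1) * 2 = classNumber K + 1 by omega, pow_succ, classNumber, pow_card_eq_one, one_mul]
      refine ⟨classGroupExtend K (κ.layer 1) (z ^ (m + 1)) / y₀, ?_⟩
      rw [div_pow, ← map_pow, ← hzsq, ← hprod, pow_two, mul_div_mul_comm, div_self', one_mul]
  obtain ⟨w, hw⟩ := hsq
  refine ⟨w * N e, ?_⟩
  rw [h, map_mul, _root_.map_div, hNσ, map_pow, mul_pow, hw]

/-- ★★ **THE GENERATOR CERTIFICATE at layer `n`.**  `K` of odd degree with `2 ∤ d_K`, `κ` cyclotomic (`K_1 = K(√2)`), `2 ∤ h_K`; `𝔭₁ ∋ 2` maximal with `𝓞_K/𝔭₁ = 𝔽₂`; every unit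
`≡ ±1 (mod 𝔭₁³)`; `π ≡ ±3 (mod 𝔭₁³)`; `𝔄 ≠ 0` an ideal of `𝓞_{K_1}` with `N_{K_1/K}(𝔄)^k = (π)` representing `N_{K_n/K_1}(c)`.  THEN `c` is not of the form `σ(b)·b⁻¹·e²`
for any `σ ∈ Gal(K_n/K)`. [cite: Gras2003, IV.4] [cite: NeukirchANT1999, Ch. III §1 (1.6)] [cite: Serre1973CourseArithmetic, Ch. III §1.2, Thm. 1] -/
theorem not_exists_eq_conj_div_mul_sq_of_genusCert_layer (hK2 : ¬ 2 ∣ Module.finrank ℚ K) (hd : ¬ (2 : ℤ) ∣ NumberField.discr K)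
    (κ : ZpExtension K 2) (hκ : κ.IsCyclotomic) (hh : ¬ 2 ∣ classNumber K) (n : ℕ)
    [NumberField (κ.layer 1)] [NumberField (κ.layer n)] [Algebra (κ.layer 1) (κ.layer n)] [IsScalarTower K (κ.layer 1) (κ.layer n)]
    (P : Ideal (𝓞 K)) [P.IsMaximal] (hres : ∀ r : 𝓞 K, r ∈ P ∨ r - 1 ∈ P) (h2P : (2 : 𝓞 K) ∈ P)
    (hunits : ∀ u : (𝓞 K)ˣ, (u : 𝓞 K) - 1 ∈ P ^ 3 ∨ (u : 𝓞 K) + 1 ∈ P ^ 3)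
    {π : 𝓞 K} (hπ : π - 3 ∈ P ^ 3 ∨ π + 3 ∈ P ^ 3)
    {A : Ideal (𝓞 (κ.layer 1))} (hA0 : A ≠ ⊥) {k : ℕ} (hA : Ideal.relNorm (𝓞 K) A ^ k = Ideal.span {π})
    (σ : (κ.layer n) ≃ₐ[K] (κ.layer n)) {c : ClassGroup (𝓞 (κ.layer n))}
    (hcA : classGroupNorm (κ.layer 1) (κ.layer n) c = ClassGroup.mk0 ⟨A, mem_nonZeroDivisors_of_ne_zero hA0⟩) :
    ¬ ∃ b e : ClassGroup (𝓞 (κ.layer n)), c = ClassGroup.mulEquiv (intAut σ) b / b * e ^ 2 := by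
  rintro ⟨b, e, h⟩
  obtain ⟨y, hy⟩ := exists_sq_eq_classGroupNorm_layer_one_of_layer κ hh n σ h
  rw [hcA] at hy
  haveI : IsGalois K (κ.layer 1) := κ.isGalois_layer_holds 1
  obtain ⟨s, hs⟩ := exists_sq_eq_two_layer_one_of_not_dvd_finrank hK2 κ hκ
  have hsK := forall_algebraMap_ne_of_sq_eq_two hd hs
  have h2 : Module.finrank K (κ.layer 1) = 2 := by rw [κ.finrank_layer_holds 1, pow_one]
  have hP0 : P ≠ ⊥ := fun h0 => by
    rw [h0, Ideal.mem_bot] at h2P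
    exact two_ne_zero h2P
  have h2P' : (2 : 𝓞 K) ∉ P ^ 2 := two_not_mem_sq_of_not_dvd_discr hd P h2P
  exact not_exists_sq_eq_mk0_of_genusCert h2 hs hsK (Nat.odd_iff.mpr (Nat.two_dvd_ne_zero.mp hh)) P hP0 hres h2P h2P' hunits hπ
    hA0 hA ⟨y, hy⟩

/-- ★★★ **THE RELATION DOOR AT `p = 2`, LAYER `K_{j+2}`, FROM BASE-FIELD DATA.**  `K` of odd degree with `2 ∤ d_K` and exactly two primes above `2`, `κ` a cyclotomic
`ℤ₂`-extension, `2 ∤ h_K`; `𝔭₁ ∋ 2` maximal with `𝓞_K/𝔭₁ = 𝔽₂`; every unit `≡ ±1 (mod 𝔭₁³)`; a unit `ε` of `K` with **`ε^{2^j} ∉ N_{K_{j+2}/K} K_{j+2}ˣ`** (DISPLAYED in the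
norm currency; `j = 0`: `ε ∓ 1 ∉ 𝔭₁⁴` by `unitsIncl_unitsMap_not_mem_map_norm_layer_two`); a class `c ∈ Cl(K_{j+2})` with the GENUS CERTIFICATE `(𝔄, k, π)` for `N_{K_{j+2}/K_1}(c)`;
`σ` a generator of `Gal(K_{j+2}/K)`; and **ONE RELATION `∏_{i<N} σ^i(c)^{f_i} = 1`** with `∑ f_i X^i = (X−1)^d·u + 2·g`, `u(1)` odd, **`d + 2 ≤ 2^{j+2}`**.  THEN
**`rank₂ Cl(K_m) ≤ d` for every `m`, `μ₂(κ) = 0`, `λ₂(κ) ≤ d`.** [cite: Washington1997, §13.3 Prop. 13.22–13.23] [cite: Lang1990, Ch. 13 §4 Lemma 4.1] [cite: Gras2003, IV.4]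
[cite: Fukuda1994, Thm. 1, p. 264] -/
theorem classicalMuVanishes_two_of_relation_of_genusCert_layer (hK2 : ¬ 2 ∣ Module.finrank ℚ K) (hd : ¬ (2 : ℤ) ∣ NumberField.discr K)
    (κ : ZpExtension K 2) (hκ : κ.IsCyclotomic)
    (h2card : {w : HeightOneSpectrum (𝓞 K) | ((2 : ℕ) : 𝓞 K) ∈ w.asIdeal}.ncard = 2)
    (hh : ¬ 2 ∣ classNumber K) (j : ℕ)
    [NumberField (κ.layer 1)] [NumberField (κ.layer (j + 2))] [Algebra (κ.layer 1) (κ.layer (j + 2))]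
    [IsScalarTower K (κ.layer 1) (κ.layer (j + 2))]
    (P : Ideal (𝓞 K)) [P.IsMaximal] (hres : ∀ r : 𝓞 K, r ∈ P ∨ r - 1 ∈ P) (h2P : (2 : 𝓞 K) ∈ P)
    (hunits : ∀ u : (𝓞 K)ˣ, (u : 𝓞 K) - 1 ∈ P ^ 3 ∨ (u : 𝓞 K) + 1 ∈ P ^ 3)
    (ε : (𝓞 K)ˣ)
    (hnot : (unitsIncl K (κ.layer (j + 2)) (Units.map (algebraMap (𝓞 K) K : 𝓞 K →* K) ε)) ^ 2 ^ j ∉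
      (⊤ : Subgroup (κ.layer (j + 2))ˣ).map (Herbrand.norm ((κ.layer (j + 2)) ≃ₐ[K] (κ.layer (j + 2)))))
    {π : 𝓞 K} (hπ : π - 3 ∈ P ^ 3 ∨ π + 3 ∈ P ^ 3)
    {A : Ideal (𝓞 (κ.layer 1))} (hA0 : A ≠ ⊥) {k : ℕ} (hA : Ideal.relNorm (𝓞 K) A ^ k = Ideal.span {π})
    (σ : (κ.layer (j + 2)) ≃ₐ[K] (κ.layer (j + 2))) (hσ : ∀ τ : (κ.layer (j + 2)) ≃ₐ[K] (κ.layer (j + 2)), τ ∈ Subgroup.zpowers σ)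
    {c : ClassGroup (𝓞 (κ.layer (j + 2)))}
    (hcA : classGroupNorm (κ.layer 1) (κ.layer (j + 2)) c = ClassGroup.mk0 ⟨A, mem_nonZeroDivisors_of_ne_zero hA0⟩)
    {N d : ℕ} (hd2 : d + 2 ≤ 2 ^ (j + 2)) {f : ℕ → ℤ} {u g : ℤ[X]} (hu : ¬ (2 : ℤ) ∣ u.eval 1)
    (hF : (∑ i ∈ range N, C (f i) * X ^ i : ℤ[X]) = (X - 1) ^ d * u + C (2 : ℤ) * g)
    (hrel : ∏ i ∈ range N, (ClassGroup.mulEquiv (intAut (σ ^ i)) c) ^ (f i) = 1) :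
    (∀ m, classGroupPRank κ m ≤ d) ∧ ClassicalMuVanishes κ ∧ classicalLambda κ ≤ d := by
  haveI : Fact (Nat.Prime 2) := ⟨Nat.prime_two⟩
  have hodd := forall_odd_ramificationIdx_of_not_dvd_discr hd
  have hκ0 : TotallyRamifiedFrom κ 0 := totallyRamifiedFrom_zero_of_forall_odd_ramificationIdx hK2 κ hκ hodd
  -- `4 ∤ #Cl(K_{j+2})^G` from `ε^{2^j} ∉ N`
  have hfix : ¬ 2 ^ 2 ∣ Nat.card {c : ClassGroup (𝓞 (κ.layer (j + 2))) //
      ∀ τ : (κ.layer (j + 2)) ≃ₐ[K] (κ.layer (j + 2)), ClassGroup.mulEquiv (intAut τ) c = c} := by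
    rw [show (2 : ℕ) ^ 2 = 4 by norm_num]
    exact not_four_dvd_card_fixed_layer_of_pow_not_mem κ hκ0 hh j
      (by rw [ncard_ramified_layer_eq_ncard_dyadic hK2 κ hκ hodd (by omega : 1 ≤ j + 2), h2card])
      (unitsIncl_unitsMap_mem_unitsE_inf_range ε) hnot
  have hc := not_exists_eq_conj_div_mul_sq_of_genusCert_layer hK2 hd κ hκ hh (j + 2) P hres h2P hunits hπ hA0 hA σ hcA
  have hp2 : ¬ ((2 : ℕ) : ℤ) ∣ u.eval 1 := by exact_mod_cast hu
  have hF' : (∑ i ∈ range N, C (f i) * X ^ i : ℤ[X]) = (X - 1) ^ d * u + C (((2 : ℕ) : ℤ)) * g := by exact_mod_cast hF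
  exact classicalMuVanishes_and_classicalLambda_le_of_relation κ hκ0 σ hσ hfix hc (by exact_mod_cast hd2) hp2 hF' hrel

end Layer

end Literature.NumberTheory.IwasawaTheory

end
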